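import Literature.NumberTheory.Automorphic.Liu2021.LemD1DataOfPlace
import Literature.NumberTheory.Automorphic.QuadraticLocalNormCompatibility
import Literature.NumberTheory.Automorphic.UnitaryGroupSymplecticCarriers
import Literature.NumberTheory.Automorphic.QuaternionAlgebraHasse
import Literature.NumberTheory.Automorphic.QuaternionRamificationParityHolds
import Literature.NumberTheory.QuadraticForms.HilbertSymbolArchimedean
import HarnessLib

/-!
# [Liu2021, Lem. D.1 (4)] at `n = 2`: the hermitian PLANE `(E_v², diag(t₀, t₁) ⊗ 1)` of the local datum is isotropic
# iff the Hilbert symbol `(d, −t₀t₁)_v` is `1`; the anisotropic places have the parity of Hilbert reciprocity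

Topic `NumberTheory/Automorphic/Liu2021`; namespace `Literature.NumberTheory.Automorphic.Liu2021.LemD1OfPlace` (the local model
`E_v = E ⊗_F F_v` of `LemD1DataOfPlace.lean`).  KERNEL ONLY: theorems, no definition, no named fact, no `sorry`.  Nothing of
[Liu2021] is asserted.  Binary complement of ★ `LemD1IsotropyOfPlace.lean` (rank `≥ 3`: always isotropic).

**What is proved.**  Let `E/F` be a quadratic extension of number fields with non-trivial automorphism `c`, `c δ = −δ ≠ 0`,
`δ² = d ∈ F`, and `J = diag(t₀, t₁) ⊗ 1` with `t₀ t₁ ≠ 0` in `F`.  In [Liu2021, App. D Lemma D.1 (4)] the isomorphism criterion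
for the local oscillator representations at `n = 2` splits according to «`V` is isotropic (resp. anisotropic)»
(`LemD1.IsIsotropic` of the standing data `LemD1OfPlace.standingData … v …`, READING L2 of `LemD1AsPrinted.lean`).

* §1 `form_self_eq_toLocalRing_sum` — on the standing data at a finite place `v` of `F` for the diagonal Gram matrix,
  `h(u, u) = ι_v (Σ_i t_i · N_{E_v/F_v}(u_i))` (`ι_v(N y) = y · (c ⊗ 1) y`, tree `toLocalRing_algebraNorm`);
  `eq_zero_of_algebraNorm_eq_zero` — if `d` is not a square in `F_v`, the norm form `a² − d b²` of `E_v` is anisotropic.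
* §2 **`isIsotropic_standingData_iff_hilbertSymbol_eq_one`** — `V_v = (E_v², diag(t₀,t₁) ⊗ 1)` is isotropic iff
  `(d, −t₀t₁)_{F_v} = 1` (O'Meara §63B: `−t₀/t₁ ∈ N(E_vˣ)`; if `E_v` splits both sides hold).  This is the local invariant of a
  hermitian plane [Landherr 1936; Scharlau Ch. 10 §1; Shimura 2008 Lemma 1.6] in the tree's Hilbert-symbol currency.
* §3 **`finite_setOf_not_isIsotropic`**, **`even_ncard_not_isIsotropic_add_ncard_pos`** — for `d` totally negative (the CM case):
  the finite places `v` at which `V_v` is anisotropic form a finite set, and their number plus the number of real places `w` of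
  `F` with `w(t₀t₁) > 0` (the definite places of the plane) is EVEN — Hilbert's reciprocity law ★ `hilbertReciprocity_holds`
  (O'Meara 71:18) for `(d, −t₀t₁)` read through §2 and ★ `setOf_hilbertSymbol_completion_eq_neg_one`.

Consumer: the d6 line of cell hodgecm-mathlib (`Cruxes/HLiu418/Lines/d6_cm_curve`, S1b Case-B relabel `(μ, ε) ↦ (μᶜχ̌, ε′)` of
[Liu2021, Lem. D.1 (4) + Rem. D.5]: `ε′ ≠ ε` exactly on the anisotropic set, whose parity this file computes).  HC_CM is proved only
modulo the 7 printed citations until rung 0 closes; this file proves no cell binder.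

## References
* [Liu2021] Y. Liu, *Fourier–Jacobi cycles and arithmetic relative trace formula*, Camb. J. Math. 9 (2021) = arXiv:2102.11518,
  App. D Lemma D.1 (1) l. 5229 («unless `V` is anisotropic (in particular `n = 2`)»), (4) l. 5235 («when `V` is isotropic (resp.
  anisotropic)»).
* [Omeara1963] O. T. O'Meara, *Introduction to Quadratic Forms* (1963), §63B (Hilbert symbol and binary forms), §71 Thm. 71:18.
* [Landherr1936HermitianForms] W. Landherr, Abh. Math. Sem. Hamburg 11 (1936) 245–248.
* [Scharlau1985HermitianForms] W. Scharlau, *Quadratic and Hermitian Forms*, Grundlehren 270 (1985), Ch. 10 §1.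
* [CasselsFrohlichANT1967] J. W. S. Cassels, A. Fröhlich (eds.), *Algebraic Number Theory* (1967), Ch. II §10 (`E ⊗_F F_v`).
-/

set_option autoImplicit false

noncomputable section

open scoped Matrix
open NumberField IsDedekindDomain
open Literature.NumberTheory.Automorphic.UnitaryGroup
open Literature.NumberTheory.QuadraticForms (hilbertSymbol)
open Literature.RepresentationTheory.Liu2021 (OscillatorStandingData)

namespace Literature.NumberTheory.Automorphic.Liu2021.LemD1OfPlace

variable {F : Type} (E : Type) [Field F] [NumberField F] [Field E] [NumberField E] [Algebra F E]
  [Algebra.IsQuadraticExtension F E] (v : HeightOneSpectrum (𝓞 F)) (c : E ≃ₐ[F] E) {δ : E}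

/-! ## §1 The diagonal hermitian form at `v` as a sum of norms; the norm form of `E_v` -/

/-- `N_{E_v/F_v}(ι_v x) = x²` (`[E ⊗_F F_v : F_v] = [E : F] = 2`, tree `finrank_localRing`).
[cite: CasselsFrohlichANT1967, Ch. II §10] -/
theorem algebraNorm_toLocalRing (x : v.adicCompletion F) :
    Algebra.norm (v.adicCompletion F) (toLocalRing E v x) = x ^ 2 := by
  rw [← algebraMap_localRing_eq, Algebra.norm_algebraMap, finrank_localRing E v]

/-- the coercion `F → F_v` is the structure map (definitional). [folklore] -/
private theorem coe_adicCompletion_eq_algebraMap (x : F) :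
    (x : v.adicCompletion F) = algebraMap F (v.adicCompletion F) x := rfl

omit [NumberField E] [Algebra.IsQuadraticExtension F E] in
/-- `d ≠ 0` in `F_v` when `δ² = d`, `δ ≠ 0`. [folklore] -/
private theorem coe_ne_zero_of_mul_self_eq (hδ : δ ≠ 0) {d : F} (hd : δ * δ = algebraMap F E d) :
    (algebraMap F (v.adicCompletion F) d) ≠ 0 := by
  intro h
  have hd0 : d = 0 := (map_eq_zero _).1 h
  rw [hd0, map_zero, mul_self_eq_zero] at hd
  exact hδ hd

/-- **The norm form of `E_v` is anisotropic when `d` is a non-square in `F_v`**: `N(ι_v a + ι_v b δ) = a² − d b² = 0` forces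
`a = b = 0`. [cite: Omeara1963, §63B] -/
theorem eq_zero_of_algebraNorm_eq_zero (hcδ : c δ = -δ) (hδ : δ ≠ 0) {d : F} (hd : δ * δ = algebraMap F E d)
    (hnd : ¬ IsSquare (algebraMap F (v.adicCompletion F) d)) (y : LocalRing E v)
    (hy : Algebra.norm (v.adicCompletion F) y = 0) : y = 0 := by
  obtain ⟨⟨a, b⟩, rfl⟩ := (quadraticLocalEquiv E v c hcδ hδ).surjective y
  rw [algebraNorm_quadraticLocalEquiv E v c hcδ hδ hd, coe_adicCompletion_eq_algebraMap] at hy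
  by_cases hb : b = 0
  · have ha : a * a = 0 := by simpa [hb] using hy
    rw [mul_self_eq_zero.1 ha, hb]
    exact map_zero _
  · exact absurd ⟨a / b, by rw [div_mul_div_comm, eq_div_iff (mul_ne_zero hb hb)]; linear_combination -hy⟩ hnd

/-- **The diagonal hermitian form at `v` is a sum of norms**: for `J = diag(t₀, t₁) ⊗ 1`,
`h(u, u) = ι_v (t₀ · N(u₀) + t₁ · N(u₁))` on `E_v²`. [cite: Liu2021, App. D §D.1 (l. 5213–5215)] -/
theorem form_self_eq_toLocalRing_sum (hcδ : c δ = -δ) (hδ : δ ≠ 0) (t : Fin 2 → F) {J : Matrix (Fin 2) (Fin 2) E}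
    (hJ : J = (Matrix.diagonal t).map (algebraMap F E)) (hJh : (J.map c)ᵀ = J) (hJdet : J.det ≠ 0) (u : Fin 2 → LocalRing E v) :
    (standingData E v c 2 J hcδ hδ le_rfl hJh hJdet).form u u =
      toLocalRing E v (∑ i, (algebraMap F (v.adicCompletion F) (t i)) * Algebra.norm (v.adicCompletion F) (u i)) := by
  have hgram : (standingData E v c 2 J hcδ hδ le_rfl hJh hJdet).gram =
      Matrix.diagonal fun i => toLocalRing E v (algebraMap F (v.adicCompletion F) (t i)) := by
    rw [standingData_gram, localForm_eq_map E 2 v (Matrix.diagonal t) hJ, Matrix.diagonal_map (map_zero _),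
      Matrix.diagonal_map (map_zero _)]
  unfold OscillatorStandingData.form Literature.AlgebraicGeometry.ShimuraVarieties.hermForm
  rw [hgram, map_sum]
  simp only [dotProduct, Matrix.mulVec_diagonal, Function.comp_apply, OscillatorStandingData.σ_apply,
    standingData_conj_apply]
  refine Finset.sum_congr rfl fun i _ => ?_
  rw [map_mul, toLocalRing_algebraNorm E v c hcδ hδ (u i)]
  ring

/-! ## §2 Isotropy of the plane at `v` ⟺ `(d, −t₀t₁)_v = 1` -/

/-- **[Liu2021, Lem. D.1 (4)]'s «`V` isotropic / anisotropic» at `n = 2`, read as a Hilbert symbol**: the hermitian plane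
`(E_v², diag(t₀, t₁) ⊗ 1)` of the standing data at `v` is isotropic iff `(d, −t₀t₁)_{F_v} = 1` (`δ² = d`), i.e. iff
`−t₀t₁ = a² − d b²` is soluble in `F_v` (when `E_v` is split, `d` is a square and both sides hold).
[cite: Omeara1963, §63B] [cite: Liu2021, App. D Lemma D.1 (4) (l. 5235)] -/
theorem isIsotropic_standingData_iff_hilbertSymbol_eq_one (hcδ : c δ = -δ) (hδ : δ ≠ 0) (t : Fin 2 → F) {J : Matrix (Fin 2) (Fin 2) E}
    (hJ : J = (Matrix.diagonal t).map (algebraMap F E)) (hJh : (J.map c)ᵀ = J) (hJdet : J.det ≠ 0)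
    {d : F} (hd : δ * δ = algebraMap F E d) (ht : ∀ i, t i ≠ 0) :
    LemD1.IsIsotropic (standingData E v c 2 J hcδ hδ le_rfl hJh hJdet) ↔
      hilbertSymbol (v.adicCompletion F) (algebraMap F _ d) (algebraMap F _ (-(t 0 * t 1))) = 1 := by
  haveI : CharZero (v.adicCompletion F) := charZero_of_injective_algebraMap (algebraMap F _).injective
  haveI : NeZero (2 : v.adicCompletion F) := ⟨two_ne_zero⟩
  have hd0 := coe_ne_zero_of_mul_self_eq E v hδ hd
  have ht0' : algebraMap F (v.adicCompletion F) (-(t 0 * t 1)) ≠ 0 :=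
    (map_ne_zero _).2 (neg_ne_zero.2 (mul_ne_zero (ht 0) (ht 1)))
  set Ψ := quadraticLocalEquiv E v c hcδ hδ with hΨ
  -- the form as a sum of norms, read in `F_v`
  have hform : ∀ u : Fin 2 → LocalRing E v, (standingData E v c 2 J hcδ hδ le_rfl hJh hJdet).form u u = 0 ↔
      algebraMap F (v.adicCompletion F) (t 0) * Algebra.norm (v.adicCompletion F) (u 0) +
        algebraMap F (v.adicCompletion F) (t 1) * Algebra.norm (v.adicCompletion F) (u 1) = 0 := by
    intro u
    rw [form_self_eq_toLocalRing_sum E v c hcδ hδ t hJ hJh hJdet u, Fin.sum_univ_two,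
      ← map_zero (toLocalRing E v), (toLocalRing_injective E v).eq_iff]
  constructor
  · rintro ⟨u, hu, h0⟩
    rw [hform] at h0
    by_cases hsq : IsSquare (algebraMap F (v.adicCompletion F) d)
    · exact Literature.NumberTheory.QuadraticForms.hilbertSymbol_eq_one_of_isSquare hsq hd0 _
    -- `E_v` is a field: both coordinates have non-zero norm
    have hn : ∀ i, Algebra.norm (v.adicCompletion F) (u i) ≠ 0 := by
      have key : ∀ i j, i ≠ j → Algebra.norm (v.adicCompletion F) (u i) = 0 → False := by
        intro i j hij hi
        have hui : u i = 0 := eq_zero_of_algebraNorm_eq_zero E v c hcδ hδ hd hsq (u i) hi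
        have hj' : algebraMap F (v.adicCompletion F) (t j) * Algebra.norm (v.adicCompletion F) (u j) = 0 := by
          fin_cases i <;> fin_cases j <;> simp_all
        have huj : u j = 0 := eq_zero_of_algebraNorm_eq_zero E v c hcδ hδ hd hsq (u j)
          ((mul_eq_zero.1 hj').resolve_left ((map_ne_zero _).2 (ht j)))
        apply hu
        funext k
        fin_cases i <;> fin_cases j <;> first | exact absurd rfl hij | (fin_cases k <;> assumption)
      intro i hi
      fin_cases i
      · exact key 0 1 (by decide) hi
      · exact key 1 0 (by decide) hi
    set n0 := Algebra.norm (v.adicCompletion F) (u 0) with hn0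
    set n1 := Algebra.norm (v.adicCompletion F) (u 1) with hn1
    -- `−t₀t₁ = N(ι t₁ · u₀ · u₁ · ι n₀⁻¹)`
    set z : LocalRing E v := toLocalRing E v (algebraMap F _ (t 1)) * u 0 * u 1 * toLocalRing E v n0⁻¹ with hz
    have hn0' : n0 ≠ 0 := hn 0
    have hNz : Algebra.norm (v.adicCompletion F) z = algebraMap F (v.adicCompletion F) (-(t 0 * t 1)) := by
      rw [hz, map_mul, map_mul, map_mul, algebraNorm_toLocalRing, algebraNorm_toLocalRing, ← hn0, ← hn1, map_neg,
        map_mul]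
      field_simp
      linear_combination (algebraMap F (v.adicCompletion F) (t 1)) * h0
    obtain ⟨⟨a, b⟩, hab⟩ := Ψ.surjective z
    refine (isNormFromSqrt_iff_hilbertSymbol_eq_one hd0 ht0').1 ((isNormFromSqrt_iff).2 ⟨a, b, ?_⟩)
    rw [← hNz, ← hab, hΨ, algebraNorm_quadraticLocalEquiv E v c hcδ hδ hd, coe_adicCompletion_eq_algebraMap]
    ring
  · intro h
    obtain ⟨a, b, hab⟩ := (isNormFromSqrt_iff).1 ((isNormFromSqrt_iff_hilbertSymbol_eq_one hd0 ht0').2 h)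
    refine ⟨![toLocalRing E v (algebraMap F _ (t 1)), Ψ (a, b)], ?_, ?_⟩
    · intro hu
      have h1 := congr_fun hu 0
      simp only [Matrix.cons_val_zero, Pi.zero_apply] at h1
      exact (map_ne_zero _).2 (ht 1) ((toLocalRing_injective E v) (by rw [h1, map_zero]))
    · rw [hform]
      simp only [Matrix.cons_val_zero, Matrix.cons_val_one]
      rw [algebraNorm_toLocalRing, hΨ, algebraNorm_quadraticLocalEquiv E v c hcδ hδ hd, coe_adicCompletion_eq_algebraMap]
      rw [map_neg, map_mul] at hab
      linear_combination (algebraMap F (v.adicCompletion F) (t 1)) * hab.symm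

/-- … hence anisotropic iff `(d, −t₀t₁)_v = −1`. [cite: Omeara1963, §63B] [cite: Liu2021, App. D Lemma D.1 (4) (l. 5235)] -/
theorem not_isIsotropic_standingData_iff_hilbertSymbol_eq_neg_one (hcδ : c δ = -δ) (hδ : δ ≠ 0) (t : Fin 2 → F) {J : Matrix (Fin 2) (Fin 2) E}
    (hJ : J = (Matrix.diagonal t).map (algebraMap F E)) (hJh : (J.map c)ᵀ = J) (hJdet : J.det ≠ 0)
    {d : F} (hd : δ * δ = algebraMap F E d) (ht : ∀ i, t i ≠ 0) :
    ¬ LemD1.IsIsotropic (standingData E v c 2 J hcδ hδ le_rfl hJh hJdet) ↔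
      hilbertSymbol (v.adicCompletion F) (algebraMap F _ d) (algebraMap F _ (-(t 0 * t 1))) = -1 := by
  exact (not_congr (isIsotropic_standingData_iff_hilbertSymbol_eq_one E v c hcδ hδ t hJ hJh hJdet hd ht)).trans
    (Literature.NumberTheory.QuadraticForms.hilbertSymbol_ne_one_iff _ _)

/-! ## §3 Parity of the anisotropic places (Hilbert reciprocity for `(d, −t₀t₁)`) -/

/-- **The anisotropic places of the plane form a finite set** (`d` totally negative, e.g. the CM case).
[cite: Omeara1963, §71 Thm. 71:18] -/
theorem finite_setOf_not_isIsotropic (hcδ : c δ = -δ) (hδ : δ ≠ 0) (t : Fin 2 → F) {J : Matrix (Fin 2) (Fin 2) E}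
    (hJ : J = (Matrix.diagonal t).map (algebraMap F E)) (hJh : (J.map c)ᵀ = J) (hJdet : J.det ≠ 0)
    {d : F} (hd : δ * δ = algebraMap F E d) (ht : ∀ i, t i ≠ 0) :
    {v : HeightOneSpectrum (𝓞 F) |
      ¬ LemD1.IsIsotropic (standingData E v c 2 J hcδ hδ le_rfl hJh hJdet)}.Finite := by
  have hd0 : d ≠ 0 := by
    rintro rfl
    rw [map_zero, mul_self_eq_zero] at hd
    exact hδ hd
  have ht0 : -(t 0 * t 1) ≠ 0 := neg_ne_zero.2 (mul_ne_zero (ht 0) (ht 1))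
  obtain ⟨hfin, -⟩ := Literature.NumberTheory.QuadraticForms.hilbertReciprocity_holds F d (-(t 0 * t 1)) hd0 ht0
  refine hfin.subset fun v hv => ?_
  exact (not_isIsotropic_standingData_iff_hilbertSymbol_eq_neg_one E v c hcδ hδ t hJ hJh hJdet hd ht).1 hv

/-- **Parity of the anisotropic places of a hermitian plane** (Landherr's local-invariant relation for rank 2, as Hilbert
reciprocity for `(d, −t₀t₁)`): for `d` negative at every real place of `F`, the number of finite places `v` at which
`(E_v², diag(t₀,t₁) ⊗ 1)` is anisotropic plus the number of real places `w` with `w(t₀ t₁) > 0` (the places where the plane is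
definite) is even. [cite: Omeara1963, §71 Thm. 71:18] [cite: Landherr1936HermitianForms] -/
theorem even_ncard_not_isIsotropic_add_ncard_pos (hcδ : c δ = -δ) (hδ : δ ≠ 0) (t : Fin 2 → F) {J : Matrix (Fin 2) (Fin 2) E}
    (hJ : J = (Matrix.diagonal t).map (algebraMap F E)) (hJh : (J.map c)ᵀ = J) (hJdet : J.det ≠ 0)
    {d : F} (hd : δ * δ = algebraMap F E d) (ht : ∀ i, t i ≠ 0)
    (hdneg : ∀ (w : InfinitePlace F) (hw : w.IsReal), InfinitePlace.embedding_of_isReal hw d < 0) :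
    Even ({v : HeightOneSpectrum (𝓞 F) |
        ¬ LemD1.IsIsotropic (standingData E v c 2 J hcδ hδ le_rfl hJh hJdet)}.ncard +
      {w : InfinitePlace F | ∃ hw : w.IsReal, 0 < InfinitePlace.embedding_of_isReal hw (t 0 * t 1)}.ncard) := by
  have hd0 : d ≠ 0 := by
    rintro rfl
    rw [map_zero, mul_self_eq_zero] at hd
    exact hδ hd
  have ht0 : -(t 0 * t 1) ≠ 0 := neg_ne_zero.2 (mul_ne_zero (ht 0) (ht 1))
  obtain ⟨-, heven⟩ := Literature.NumberTheory.QuadraticForms.hilbertReciprocity_holds F d (-(t 0 * t 1)) hd0 ht0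
  have hfinite : {v : HeightOneSpectrum (𝓞 F) |
      ¬ LemD1.IsIsotropic (standingData E v c 2 J hcδ hδ le_rfl hJh hJdet)} =
      {v : HeightOneSpectrum (𝓞 F) |
        hilbertSymbol (v.adicCompletion F) (algebraMap F _ d) (algebraMap F _ (-(t 0 * t 1))) = -1} := by
    ext v
    exact not_isIsotropic_standingData_iff_hilbertSymbol_eq_neg_one E v c hcδ hδ t hJ hJh hJdet hd ht
  have hinf : {w : InfinitePlace F | ∃ hw : w.IsReal, 0 < InfinitePlace.embedding_of_isReal hw (t 0 * t 1)} =
      {w : InfinitePlace F |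
        hilbertSymbol w.Completion (algebraMap F _ d) (algebraMap F _ (-(t 0 * t 1))) = -1} := by
    rw [Literature.NumberTheory.QuadraticForms.setOf_hilbertSymbol_completion_eq_neg_one hd0 ht0]
    ext w
    simp only [Set.mem_setOf_eq, map_neg, neg_lt_zero]
    exact ⟨fun ⟨hw, h⟩ => ⟨hw, hdneg w hw, h⟩, fun ⟨hw, _, h⟩ => ⟨hw, h⟩⟩
  rw [hfinite, hinf]
  exact heven

end Literature.NumberTheory.Automorphic.Liu2021.LemD1OfPlace

end
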